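import Literature.Analysis.FluidPDE.TaoSymbolLocalisation
import HarnessLib

/-!
# Tao's averaged Navier–Stokes setting: rotation/dilation invariance of `‖m‖_k` and summed (3.5)

T. Tao, *Finite time blowup for an averaged three-dimensional Navier–Stokes equation*,
J. Amer. Math. Soc. **29** (2016), 601–674 = arXiv:1402.0290v3 (held as `paper:arxiv-1402.0290`),
§3.2, pp. 15–16: "Note that `𝓜₀ ⊗ ℂ` is closed under composition, and from (1.10) and the
Leibniz rule we have the inequalities
`‖m(D) m'(D)‖_k ≤ C_k Σ_{k₁=0}^k Σ_{k₂=0}^k ‖m(D)‖_{k₁} ‖m'(D)‖_{k₂}` … From this, Fubini's theorem,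
and Hölder's inequality, together with the observation that rotation and dilation operators
normalise `𝓜₀ ⊗ ℂ`, we have the following transitivity property". Support file for the
discharge of the named fact `Literature.Analysis.FluidPDE.Tao2016.complexAverage_trans`
(`TaoAveragedCascadeSteps.lean`), on top of the accepted Leibniz bound `symbolSeminorm_mul_le` and
dilation invariance `symbolSeminorm_comp_smul_le` of `TaoSymbolLocalisation.lean` and the
measurability of `ω ↦ ‖m_{i,ω}‖_k` of `TaoSymbolSeminormMeasurable.lean`:

* `symbolSeminorm_comp_smul_isometry_le`, `IsComplexSymbol.comp_smul_isometry` — **rotations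
  and dilations normalise `𝓜₀ ⊗ ℂ`**: `‖m(a R ·)‖_k ≤ ‖m‖_k` for `a ≠ 0` and a linear isometry
  `R` (the symbol of `Rot_R Dil_λ m(D) Dil_λ⁻¹ Rot_R⁻¹` is `m(λ⁻¹ R⁻¹ ·)`; the seminorms (1.10)
  are scale and rotation invariant);
* `symbolSeminorm_mul_comp_le` — the form used for a composite average:
  `‖f · g(a R ·)‖_k ≤ c_k (Σ_{j ≤ K} ‖f‖_j) (Σ_{j ≤ K} ‖g‖_j)` for `k ≤ K`, `c_k = Σ_j (k choose j)`;
* `ComplexAveragingDatum.lintegral_sum_symbolSeminorm_lt_top` — the integrability conditions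
  (3.5) give `∫_Ω ∏ᵢ (Σ_{j ≤ K} ‖m_{i,ω}‖_j) dμ < ∞` (expand and use (3.5) for each triple; the
  interchange of sum and integral uses the measurability of `ω ↦ ‖m_{i,ω}‖_j`).

## References

* T. Tao, J. Amer. Math. Soc. 29 (2016), 601–674, arXiv:1402.0290v3, §1.1 (1.10) p. 6,
  §3.1 Def. 3.4 (3.5) p. 15, §3.2 pp. 15–16. Key `Tao2016AveragedNS`.
-/

noncomputable section

open MeasureTheory Set Filter Topology
open scoped ENNReal NNReal

namespace Literature.Analysis.FluidPDE.Tao2016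

/-! ### Rotations and dilations normalise `𝓜₀ ⊗ ℂ` -/

/-- The iterated derivative of `f ∘ T` for a continuous linear automorphism `T` (no smoothness
needed: Mathlib's `ContinuousLinearEquiv.iteratedFDerivWithin_comp_right` on `univ`). [folklore] -/
theorem iteratedFDeriv_comp_continuousLinearEquiv
    (T : EuclideanSpace ℝ (Fin 3) ≃L[ℝ] EuclideanSpace ℝ (Fin 3)) (f : EuclideanSpace ℝ (Fin 3) → ℂ)
    (x : EuclideanSpace ℝ (Fin 3)) (i : ℕ) :
    iteratedFDeriv ℝ i (f ∘ T) x =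
      (iteratedFDeriv ℝ i f (T x)).compContinuousLinearMap fun _ =>
        (T : EuclideanSpace ℝ (Fin 3) →L[ℝ] EuclideanSpace ℝ (Fin 3)) := by
  have h := T.iteratedFDerivWithin_comp_right f uniqueDiffOn_univ (mem_univ (T x)) i
  rwa [preimage_univ, iteratedFDerivWithin_univ, iteratedFDerivWithin_univ] at h

/-- **Rotation and dilation operators normalise `𝓜₀ ⊗ ℂ`** (Tao 2016, §3.2 p. 16), at the level
of seminorms: for `a ≠ 0` and a linear isometry `R` of `ℝ³`, `‖m(a R ·)‖_k ≤ ‖m‖_k` (indeed `=`;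
the seminorms (1.10) are invariant under rotations and dilations of the frequency variable:
`|ξ|ᵏ ‖∇ᵏ(m ∘ T)(ξ)‖ ≤ |ξ|ᵏ |a|ᵏ ‖∇ᵏ m(Tξ)‖ = |Tξ|ᵏ ‖∇ᵏ m(Tξ)‖`, `T = a R`). [cite: Tao2016AveragedNS, §3.2 p. 16] -/
theorem symbolSeminorm_comp_smul_isometry_le (m : EuclideanSpace ℝ (Fin 3) → ℂ) {a : ℝ} (ha : a ≠ 0)
    (A : EuclideanSpace ℝ (Fin 3) ≃ₗᵢ[ℝ] EuclideanSpace ℝ (Fin 3)) (k : ℕ) :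
    symbolSeminorm k (fun ξ => m (a • A ξ)) ≤ symbolSeminorm k m := by
  -- the continuous linear automorphism `T ξ = a • A ξ`
  set T : EuclideanSpace ℝ (Fin 3) ≃L[ℝ] EuclideanSpace ℝ (Fin 3) := ContinuousLinearEquiv.equivOfInverse
    (a • (A.toContinuousLinearEquiv : EuclideanSpace ℝ (Fin 3) →L[ℝ] EuclideanSpace ℝ (Fin 3)))
    (a⁻¹ • (A.symm.toContinuousLinearEquiv : EuclideanSpace ℝ (Fin 3) →L[ℝ] EuclideanSpace ℝ (Fin 3)))
    (fun x => by simp [smul_smul, ha])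
    (fun x => by simp [smul_smul, ha]) with hT_def
  have hT : ∀ x, T x = a • A x := fun x => rfl
  have hTn : ∀ x, ‖T x‖ = ‖a‖ * ‖x‖ := fun x => by rw [hT, norm_smul, A.norm_map]
  have hTop : ‖(T : EuclideanSpace ℝ (Fin 3) →L[ℝ] EuclideanSpace ℝ (Fin 3))‖ ≤ ‖a‖ :=
    ContinuousLinearMap.opNorm_le_bound _ (norm_nonneg a) fun x => (hTn x).le
  have hcomp : (fun ξ => m (a • A ξ)) = m ∘ T := rfl
  rw [hcomp]
  refine iSup₂_le fun ξ hξ => ?_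
  have hξ' : ξ ≠ 0 := hξ
  have hTξ : T ξ ≠ 0 := fun h => hξ' (T.injective (h.trans (map_zero T).symm))
  have h1 : ‖iteratedFDeriv ℝ k (m ∘ T) ξ‖ ≤ ‖a‖ ^ k * ‖iteratedFDeriv ℝ k m (T ξ)‖ := by
    rw [iteratedFDeriv_comp_continuousLinearEquiv]
    refine (ContinuousMultilinearMap.norm_compContinuousLinearMap_le _ _).trans ?_
    rw [Finset.prod_const, Finset.card_univ, Fintype.card_fin, mul_comm]
    exact mul_le_mul_of_nonneg_right (pow_le_pow_left₀ (norm_nonneg _) hTop k) (norm_nonneg _)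
  have h1' : ‖iteratedFDeriv ℝ k (m ∘ T) ξ‖₊ ≤ ‖a‖₊ ^ k * ‖iteratedFDeriv ℝ k m (T ξ)‖₊ := by
    rw [← NNReal.coe_le_coe]
    push_cast
    exact h1
  have h2 : (‖T ξ‖₊ : ℝ≥0∞) = ‖a‖₊ * ‖ξ‖₊ := by
    rw [← ENNReal.coe_mul, ENNReal.coe_inj, ← NNReal.coe_inj]
    push_cast
    exact hTn ξ
  calc (‖ξ‖₊ : ℝ≥0∞) ^ k * ‖iteratedFDeriv ℝ k (m ∘ T) ξ‖₊
      ≤ (‖ξ‖₊ : ℝ≥0∞) ^ k * ((‖a‖₊ : ℝ≥0∞) ^ k * ‖iteratedFDeriv ℝ k m (T ξ)‖₊) := by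
        gcongr
        have h := ENNReal.coe_le_coe.2 h1'
        push_cast at h
        exact h
    _ = (‖T ξ‖₊ : ℝ≥0∞) ^ k * ‖iteratedFDeriv ℝ k m (T ξ)‖₊ := by
        rw [h2]
        ring
    _ ≤ symbolSeminorm k m := seminormTerm_le_symbolSeminorm k m hTξ

/-- `ξ ↦ a R ξ` maps `{ξ ≠ 0}` to itself (`a ≠ 0`, `R` a linear isometry). [folklore] -/
theorem mapsTo_smul_isometry_compl_zero {a : ℝ} (ha : a ≠ 0)
    (A : EuclideanSpace ℝ (Fin 3) ≃ₗᵢ[ℝ] EuclideanSpace ℝ (Fin 3)) :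
    MapsTo (fun ξ : EuclideanSpace ℝ (Fin 3) => a • A ξ) {0}ᶜ {0}ᶜ := by
  intro ξ hξ h
  simp only [mem_compl_iff, mem_singleton_iff] at hξ
  rcases smul_eq_zero.1 h with h | h
  · exact ha h
  · exact hξ (A.injective (h.trans (map_zero A).symm))

/-- **`𝓜₀ ⊗ ℂ` is normalised by rotations and dilations**: `m(a R ·) ∈ 𝓜₀ ⊗ ℂ` for
`m ∈ 𝓜₀ ⊗ ℂ`, `a ≠ 0`, `R` a linear isometry (Tao 2016, §3.2 p. 16). [cite: Tao2016AveragedNS, §3.2 p. 16] -/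
theorem IsComplexSymbol.comp_smul_isometry {m : EuclideanSpace ℝ (Fin 3) → ℂ} (hm : IsComplexSymbol m) {a : ℝ}
    (ha : a ≠ 0) (A : EuclideanSpace ℝ (Fin 3) ≃ₗᵢ[ℝ] EuclideanSpace ℝ (Fin 3)) :
    IsComplexSymbol (fun ξ => m (a • A ξ)) :=
  ⟨hm.1.comp ((A.contDiff.const_smul a).contDiffOn) (mapsTo_smul_isometry_compl_zero ha A),
    fun k => lt_of_le_of_lt (symbolSeminorm_comp_smul_isometry_le m ha A k) (hm.2 k)⟩

/-! ### The symbol of a composite slot -/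

/-- **Seminorm bound for the symbol `f · g(a R ·)` of a composite slot** (Leibniz bound, invariance,
and `‖·‖_j ≤ Σ_{j' ≤ K} ‖·‖_{j'}`): for `k ≤ K`,
`‖f · g(a R ·)‖_k ≤ (Σ_{j ≤ k} (k choose j)) (Σ_{j ≤ K} ‖f‖_j) (Σ_{j ≤ K} ‖g‖_j)`. [cite: Tao2016AveragedNS, §3.2 pp. 15–16] -/
theorem symbolSeminorm_mul_comp_le {f g : EuclideanSpace ℝ (Fin 3) → ℂ} (hf : IsComplexSymbol f)
    (hg : IsComplexSymbol g)
    {a : ℝ} (ha : a ≠ 0) (A : EuclideanSpace ℝ (Fin 3) ≃ₗᵢ[ℝ] EuclideanSpace ℝ (Fin 3)) {k K : ℕ} (hk : k ≤ K) :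
    symbolSeminorm k (fun ξ => f ξ * g (a • A ξ)) ≤
      (∑ j ∈ Finset.range (k + 1), (k.choose j : ℝ≥0∞)) *
        (∑ j ∈ Finset.range (K + 1), symbolSeminorm j f) *
          (∑ j ∈ Finset.range (K + 1), symbolSeminorm j g) := by
  have hgT := hg.comp_smul_isometry ha A
  calc symbolSeminorm k (fun ξ => f ξ * g (a • A ξ))
      ≤ ∑ j ∈ Finset.range (k + 1), (k.choose j : ℝ≥0∞) * (symbolSeminorm j f *
          symbolSeminorm (k - j) (fun ξ => g (a • A ξ))) := symbolSeminorm_mul_le hf.1 hgT.1 k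
    _ ≤ ∑ j ∈ Finset.range (k + 1), (k.choose j : ℝ≥0∞) *
          ((∑ j ∈ Finset.range (K + 1), symbolSeminorm j f) *
            (∑ j ∈ Finset.range (K + 1), symbolSeminorm j g)) := by
        refine Finset.sum_le_sum fun j hj => ?_
        have hjK : j ∈ Finset.range (K + 1) :=
          Finset.mem_range.2 (lt_of_lt_of_le (Finset.mem_range.1 hj) (Nat.succ_le_succ hk))
        have hkjK : k - j ∈ Finset.range (K + 1) :=
          Finset.mem_range.2 (Nat.lt_succ_of_le ((Nat.sub_le k j).trans hk))
        refine mul_le_mul' le_rfl (mul_le_mul' ?_ ?_)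
        · exact Finset.single_le_sum (f := fun j => symbolSeminorm j f) (fun _ _ => zero_le) hjK
        · exact (symbolSeminorm_comp_smul_isometry_le g ha A (k - j)).trans
            (Finset.single_le_sum (f := fun j => symbolSeminorm j g) (fun _ _ => zero_le) hkjK)
    _ = _ := by
        rw [← Finset.sum_mul]
        ring

/-- The Leibniz constant `Σ_{j ≤ k} (k choose j)` is finite. [folklore] -/
theorem sum_choose_lt_top (k : ℕ) :
    (∑ j ∈ Finset.range (k + 1), (k.choose j : ℝ≥0∞)) < ∞ :=
  ENNReal.sum_lt_top.2 fun _ _ => ENNReal.natCast_lt_top _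

/-! ### The integrability conditions (3.5), summed over orders -/

namespace ComplexAveragingDatum

variable (𝒟 : ComplexAveragingDatum)

/-- `ω ↦ Σ_{j ≤ K} ‖m_{i,ω}‖_j` is measurable. [cite: Tao2016AveragedNS, Def. 3.4 (3.5)] -/
theorem measurable_sum_symbolSeminorm (i : Fin 3) (K : ℕ) :
    Measurable fun θ => ∑ j ∈ Finset.range (K + 1), symbolSeminorm j (𝒟.m i θ) :=
  Finset.measurable_fun_sum _ fun j _ => 𝒟.measurable_symbolSeminorm i j

/-- **(3.5), summed over orders**: `∫_Ω ∏ᵢ (Σ_{j ≤ K} ‖m_{i,ω}‖_j) dμ(ω) < ∞` for every `K`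
(expand the product and use (3.5) for each of the finitely many triples `(j₁, j₂, j₃)`; the
interchange of the finite sums with the integral uses the measurability of `ω ↦ ‖m_{i,ω}‖_j`). [cite: Tao2016AveragedNS, Def. 3.4 (3.5)] -/
theorem lintegral_sum_symbolSeminorm_lt_top (K : ℕ) :
    ∫⁻ θ, (∑ j ∈ Finset.range (K + 1), symbolSeminorm j (𝒟.m 0 θ)) *
        (∑ j ∈ Finset.range (K + 1), symbolSeminorm j (𝒟.m 1 θ)) *
          (∑ j ∈ Finset.range (K + 1), symbolSeminorm j (𝒟.m 2 θ)) ∂𝒟.μ < ∞ := by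
  -- expand the product of the three sums into a triple sum (index order `j₀, j₂, j₁`)
  simp_rw [Finset.sum_mul, Finset.mul_sum, Finset.sum_mul]
  have hm : ∀ j₀ j₁ j₂, Measurable fun θ => symbolSeminorm j₀ (𝒟.m 0 θ) *
      symbolSeminorm j₁ (𝒟.m 1 θ) * symbolSeminorm j₂ (𝒟.m 2 θ) :=
    fun j₀ j₁ j₂ => 𝒟.measurable_symbolSeminorm_prod j₀ j₁ j₂
  rw [lintegral_finsetSum _ fun j₀ _ => Finset.measurable_fun_sum _ fun j₂ _ =>
    Finset.measurable_fun_sum _ fun j₁ _ => hm j₀ j₁ j₂]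
  refine ENNReal.sum_lt_top.2 fun j₀ _ => ?_
  rw [lintegral_finsetSum _ fun j₂ _ => Finset.measurable_fun_sum _ fun j₁ _ => hm j₀ j₁ j₂]
  refine ENNReal.sum_lt_top.2 fun j₂ _ => ?_
  rw [lintegral_finsetSum _ fun j₁ _ => hm j₀ j₁ j₂]
  exact ENNReal.sum_lt_top.2 fun j₁ _ => 𝒟.moment j₀ j₁ j₂

end ComplexAveragingDatum

end Literature.Analysis.FluidPDE.Tao2016
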